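import Summits.Parity.BatemanHorn.Theorems.RoughParitySectorsOddSectorShareLinearOneFormShare
import Mathlib.Analysis.SpecialFunctions.Pow.Asymptotics
import HarnessLib

/-!
# Route `RoughParitySectors`, crux `OddSectorShareLinear` (stmt-Parity-15629), line `birth`:
# asymptotic inputs for the prime-background step (`…PrimeBackground.lean`)

`--supports stmt-Parity-15629` file (line lead, cycle 2). Real-analysis inputs for comparing the crux's
mixed cells (threshold `z = ⌈x^{1/U}⌉₊` on `n ≤ x`) with the rough `P_r`-cells of the sieve sequence
along a linear member `a·X + b` (variable `X = a x + b`, threshold `y(X) = ⌈((X − b)/a)^{1/U}⌉₊ = z`):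
* `tendsto_log_threshold_div_log` — `log y(X)/log X → 1/U`; `eventually_threshold_pos`,
  `eventually_threshold_le_sqrt` (`U ≥ 3`) — the hypotheses of
  `Literature.NumberTheory.Sieve.BombieriRoughCells.primeShare_of_floor`;
* `eventually_pow_threshold_gt` — `z^{⌊U⌋+1} > a x + b` eventually (so `Ω ≤ ⌊U⌋` on rough values);
* `eventually_errors_le` (= registered sub-goal `stub_primeBackgroundErrorBudget`) — the boundary
  terms `C₁ z + C₂ + 2x/z + √X + 1` are eventually `≤ δ·X/(log X)^{B'}` (`(log X)^{B'} = o(X^s)`).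
No definition, no new fact.
-/

noncomputable section

open Filter Finset Polynomial Asymptotics
open scoped BigOperators Topology
open Literature.NumberTheory.Sieve

namespace Summit.Parity.BatemanHorn.Cruxes.OddSectorShareLinear.Birth

namespace PrimeBackground

/-! ### Elementary limits -/

/-- `a x + b → ∞` along `x : ℕ` for `a > 0`. [folklore] -/
theorem tendsto_linear_atTop {a : ℝ} (ha : 0 < a) (b : ℝ) :
    Tendsto (fun x : ℕ => a * (x : ℝ) + b) atTop atTop :=
  tendsto_atTop_add_const_right _ b (Tendsto.const_mul_atTop ha tendsto_natCast_atTop_atTop)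

/-- `(log X)^B / X^s → 0` for `s > 0`. [folklore] -/
theorem tendsto_log_pow_div_rpow {s : ℝ} (hs : 0 < s) (B : ℝ) :
    Tendsto (fun X : ℝ => Real.log X ^ B / X ^ s) atTop (𝓝 0) :=
  (isLittleO_log_rpow_rpow_atTop B hs).tendsto_div_nhds_zero

/-- `log((X − b)/a)/log X → 1` (`a > 0`). [folklore] -/
theorem tendsto_log_linear_div_log {a : ℝ} (ha : 0 < a) (b : ℝ) :
    Tendsto (fun X : ℝ => Real.log ((X - b) / a) / Real.log X) atTop (𝓝 1) := by
  -- `log((X-b)/a) = log X + (log(1 - b/X) - log a)` for large `X`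
  have h1 : Tendsto (fun X : ℝ => Real.log (1 - b / X)) atTop (𝓝 0) := by
    have h : Tendsto (fun X : ℝ => 1 - b / X) atTop (𝓝 1) := by
      have := (tendsto_const_nhds (x := b)).div_atTop tendsto_id
      simpa using (tendsto_const_nhds (x := (1 : ℝ))).sub this
    have := (Real.continuousAt_log one_ne_zero).tendsto.comp h
    rw [Real.log_one] at this
    exact this
  have h2 : Tendsto (fun X : ℝ => (Real.log (1 - b / X) - Real.log a) / Real.log X) atTop (𝓝 0) :=
    (h1.sub_const (Real.log a)).div_atTop Real.tendsto_log_atTop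
  have h3 : Tendsto (fun X : ℝ => 1 + (Real.log (1 - b / X) - Real.log a) / Real.log X) atTop (𝓝 1) := by
    simpa using (tendsto_const_nhds (x := (1 : ℝ))).add h2
  refine h3.congr' ?_
  filter_upwards [eventually_gt_atTop (max b 0), eventually_gt_atTop (1 : ℝ)] with X hXb hX1
  have hX0 : 0 < X := lt_of_le_of_lt (le_max_right _ _) hXb
  have hXb' : 0 < X - b := by linarith [le_max_left b 0]
  have hL : Real.log X ≠ 0 := (Real.log_pos hX1).ne'
  have e1 : (X - b) / a = X * ((1 - b / X) / a) := by field_simp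
  have hq : (1 - b / X) / a ≠ 0 := by
    have : 0 < 1 - b / X := by
      rw [sub_pos, div_lt_one hX0]; linarith [le_max_left b 0]
    positivity
  rw [e1, Real.log_mul hX0.ne' hq, Real.log_div (by
    intro h; rw [h, zero_div] at hq; exact hq rfl) ha.ne', add_div, div_self hL]

/-! ### The threshold function `y(X) = ⌈((X − b)/a)^{1/U}⌉₊` -/

/-- For `s ≥ 1`: `s ≤ ⌈s⌉₊ ≤ 2s`. [folklore] -/
theorem ceil_le_two_mul {s : ℝ} (hs : 1 ≤ s) : (s ≤ (⌈s⌉₊ : ℝ)) ∧ ((⌈s⌉₊ : ℝ) ≤ 2 * s) :=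
  ⟨Nat.le_ceil s, by linarith [Nat.ceil_lt_add_one (by linarith : (0 : ℝ) ≤ s)]⟩

/-- Eventually `(X − b)/a ≥ 1` (`a > 0`). [folklore] -/
theorem eventually_one_le_linear {a : ℝ} (ha : 0 < a) (b : ℝ) :
    ∀ᶠ X : ℝ in atTop, 1 ≤ (X - b) / a := by
  filter_upwards [eventually_ge_atTop (a + b)] with X hX
  rw [le_div_iff₀ ha]; linarith

/-- `t ≥ 1 ⇒ t^{1/U} ≥ 1` (`U > 0`). [folklore] -/
theorem one_le_root {t U : ℝ} (ht : 1 ≤ t) (hU : 0 < U) : 1 ≤ t ^ (1 / U) :=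
  Real.one_le_rpow ht (by positivity)

/-- The threshold is eventually positive. [folklore] -/
theorem eventually_threshold_pos {a : ℝ} (ha : 0 < a) (b : ℝ) {U : ℝ} (hU : 0 < U) :
    ∀ᶠ X : ℝ in atTop, (0 : ℝ) < ⌈((X - b) / a) ^ (1 / U)⌉₊ := by
  filter_upwards [eventually_one_le_linear ha b] with X hX
  have hs := one_le_root hX hU
  exact lt_of_lt_of_le (by linarith) (ceil_le_two_mul hs).1

/-- `log y(X)/log X → 1/U` for `y(X) = ⌈((X − b)/a)^{1/U}⌉₊` (`a > 0`, `U > 0`). [folklore] -/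
theorem tendsto_log_threshold_div_log {a : ℝ} (ha : 0 < a) (b : ℝ) {U : ℝ} (hU : 0 < U) :
    Tendsto (fun X : ℝ => Real.log (⌈((X - b) / a) ^ (1 / U)⌉₊ : ℝ) / Real.log X) atTop (𝓝 (1 / U)) := by
  have hlow : Tendsto (fun X : ℝ => (1 / U) * (Real.log ((X - b) / a) / Real.log X)) atTop (𝓝 (1 / U)) := by
    simpa using (tendsto_log_linear_div_log ha b).const_mul (1 / U)
  have hup : Tendsto (fun X : ℝ => (1 / U) * (Real.log ((X - b) / a) / Real.log X) +
      Real.log 2 / Real.log X) atTop (𝓝 (1 / U)) := by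
    simpa using hlow.add ((tendsto_const_nhds (x := Real.log 2)).div_atTop Real.tendsto_log_atTop)
  refine tendsto_of_tendsto_of_tendsto_of_le_of_le' hlow hup ?_ ?_
  · filter_upwards [eventually_one_le_linear ha b, eventually_gt_atTop (1 : ℝ)] with X ht hX1
    have hL : 0 < Real.log X := Real.log_pos hX1
    have ht0 : 0 < (X - b) / a := by linarith
    have hs := one_le_root ht hU
    rw [mul_div_assoc', div_le_div_iff_of_pos_right hL, ← Real.log_rpow ht0]
    exact Real.log_le_log (by positivity) (ceil_le_two_mul hs).1
  · filter_upwards [eventually_one_le_linear ha b, eventually_gt_atTop (1 : ℝ)] with X ht hX1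
    have hL : 0 < Real.log X := Real.log_pos hX1
    have ht0 : 0 < (X - b) / a := by linarith
    have hs := one_le_root ht hU
    have hs0 : 0 < ((X - b) / a) ^ (1 / U) := by linarith
    have hy0 : (0 : ℝ) < ⌈((X - b) / a) ^ (1 / U)⌉₊ := lt_of_lt_of_le hs0 (ceil_le_two_mul hs).1
    calc Real.log (⌈((X - b) / a) ^ (1 / U)⌉₊ : ℝ) / Real.log X
        ≤ Real.log (2 * ((X - b) / a) ^ (1 / U)) / Real.log X := by
          apply div_le_div_of_nonneg_right _ hL.le
          exact Real.log_le_log hy0 (ceil_le_two_mul hs).2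
      _ = (1 / U) * (Real.log ((X - b) / a) / Real.log X) + Real.log 2 / Real.log X := by
          rw [Real.log_mul two_ne_zero hs0.ne', Real.log_rpow ht0]
          field_simp
          ring

/-- The threshold is eventually `≤ √X` when `U ≥ 3`. [folklore] -/
theorem eventually_threshold_le_sqrt {a : ℝ} (ha : 1 ≤ a) (b : ℝ) {U : ℝ} (hU : 3 ≤ U) :
    ∀ᶠ X : ℝ in atTop, (⌈((X - b) / a) ^ (1 / U)⌉₊ : ℝ) ≤ Real.sqrt X := by
  have ha0 : 0 < a := by linarith
  have hU0 : 0 < U := by linarith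
  filter_upwards [eventually_one_le_linear ha0 b, eventually_ge_atTop (max (|b|) 4096)] with X ht hX
  have hXb : |b| ≤ X := (le_max_left _ _).trans hX
  have hX4096 : (4096 : ℝ) ≤ X := (le_max_right _ _).trans hX
  have hX0 : 0 < X := by linarith
  have hX1 : 1 ≤ X := by linarith
  set t : ℝ := (X - b) / a with ht_def
  have ht1 : 1 ≤ t := ht
  have hs := one_le_root ht hU0
  -- `t ≤ 2X`
  have htX : t ≤ 2 * X := by
    rw [ht_def, div_le_iff₀ ha0]
    have : X - b ≤ X + |b| := by linarith [neg_abs_le b]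
    nlinarith
  -- `y ≤ 2 t^{1/U} ≤ 2 t^{1/3} ≤ 2 (2X)^{1/3} ≤ 4 X^{1/3}`
  have h1 : (⌈t ^ (1 / U)⌉₊ : ℝ) ≤ 2 * t ^ (1 / U) := (ceil_le_two_mul hs).2
  have h2 : t ^ (1 / U) ≤ t ^ (1 / 3 : ℝ) :=
    Real.rpow_le_rpow_of_exponent_le ht1 (by rw [div_le_div_iff_of_pos_left one_pos hU0 (by norm_num)]; exact hU)
  have h3 : t ^ (1 / 3 : ℝ) ≤ (2 * X) ^ (1 / 3 : ℝ) :=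
    Real.rpow_le_rpow (by linarith) htX (by norm_num)
  have h4 : (2 * X) ^ (1 / 3 : ℝ) ≤ 2 * X ^ (1 / 3 : ℝ) := by
    rw [Real.mul_rpow (by norm_num) hX0.le]
    apply mul_le_mul_of_nonneg_right _ (by positivity)
    calc (2 : ℝ) ^ (1 / 3 : ℝ) ≤ (2 : ℝ) ^ (1 : ℝ) :=
          Real.rpow_le_rpow_of_exponent_le one_le_two (by norm_num)
      _ = 2 := Real.rpow_one 2
  -- `4 X^{1/3} ≤ X^{1/2}` for `X ≥ 4096`
  have h5 : 4 * X ^ (1 / 3 : ℝ) ≤ Real.sqrt X := by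
    have e : Real.sqrt X = X ^ (1 / 3 : ℝ) * X ^ (1 / 6 : ℝ) := by
      rw [Real.sqrt_eq_rpow, ← Real.rpow_add hX0]; norm_num
    rw [e, mul_comm]
    apply mul_le_mul_of_nonneg_left _ (by positivity)
    have : (4 : ℝ) = (4096 : ℝ) ^ (1 / 6 : ℝ) := by
      rw [show (4096 : ℝ) = (4 : ℝ) ^ (6 : ℝ) by norm_num, ← Real.rpow_mul (by norm_num)]
      norm_num
    rw [this]
    exact Real.rpow_le_rpow (by norm_num) hX4096 (by norm_num)
  linarith

/-! ### The crux threshold `z = ⌈x^{1/U}⌉₊` along `x : ℕ` -/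

/-- For `x ≥ 1`: `x^{1/U} ≤ z ≤ 2 x^{1/U}`, `z ≥ 1`, where `z = ⌈x^{1/U}⌉₊` (`U > 0`). [folklore] -/
theorem threshold_bounds {x : ℕ} (hx : 1 ≤ x) {U : ℝ} (hU : 0 < U) :
    (x : ℝ) ^ (1 / U) ≤ (⌈(x : ℝ) ^ (1 / U)⌉₊ : ℝ) ∧ ((⌈(x : ℝ) ^ (1 / U)⌉₊ : ℝ) ≤ 2 * (x : ℝ) ^ (1 / U)) ∧
      1 ≤ ⌈(x : ℝ) ^ (1 / U)⌉₊ := by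
  have hx1 : (1 : ℝ) ≤ x := by exact_mod_cast hx
  have hs := one_le_root (t := (x : ℝ)) (by simpa using hx1) hU
  have hs' : (1 : ℝ) ≤ (x : ℝ) ^ (1 / U) := by simpa using hs
  refine ⟨(ceil_le_two_mul hs').1, (ceil_le_two_mul hs').2, ?_⟩
  exact Nat.one_le_iff_ne_zero.mpr fun h => by
    have := (ceil_le_two_mul hs').1; rw [h, Nat.cast_zero] at this; linarith

/-- **Large `Ω` does not occur eventually**: for `U ≥ 1`, `R = ⌊U⌋₊`, `a ≥ 1`: eventually in `x`,
`(⌈x^{1/U}⌉₊)^{R+1} > a x + b`. [folklore] -/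
theorem eventually_pow_threshold_gt (a b : ℝ) {U : ℝ} (hU : 1 ≤ U) :
    ∀ᶠ x : ℕ in atTop, a * x + b < ((⌈(x : ℝ) ^ (1 / U)⌉₊ : ℕ) : ℝ) ^ (⌊U⌋₊ + 1) := by
  have hU0 : 0 < U := by linarith
  set κ : ℝ := ((⌊U⌋₊ + 1 : ℕ) : ℝ) / U - 1 with hκ
  have hκ0 : 0 < κ := by
    rw [hκ, sub_pos, lt_div_iff₀ hU0, one_mul]
    have := Nat.lt_floor_add_one U
    exact_mod_cast this
  have ht : Tendsto (fun x : ℕ => ((x : ℝ)) ^ κ) atTop atTop :=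
    (tendsto_rpow_atTop hκ0).comp tendsto_natCast_atTop_atTop
  filter_upwards [ht.eventually (eventually_ge_atTop (a + |b| + 1)), eventually_ge_atTop 1] with x hx hx1
  have hx1' : (1 : ℝ) ≤ x := by exact_mod_cast hx1
  have hx0 : (0 : ℝ) < x := by linarith
  obtain ⟨hz1, -, -⟩ := threshold_bounds hx1 hU0
  have hzpow : ((x : ℝ) ^ (1 / U)) ^ (⌊U⌋₊ + 1) ≤ ((⌈(x : ℝ) ^ (1 / U)⌉₊ : ℕ) : ℝ) ^ (⌊U⌋₊ + 1) :=
    pow_le_pow_left₀ (by positivity) hz1 _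
  have hxpow : ((x : ℝ) ^ (1 / U)) ^ (⌊U⌋₊ + 1) = (x : ℝ) ^ κ * x := by
    rw [← Real.rpow_natCast, ← Real.rpow_mul hx0.le, hκ]
    rw [show 1 / U * ((⌊U⌋₊ + 1 : ℕ) : ℝ) = (((⌊U⌋₊ + 1 : ℕ) : ℝ) / U - 1) + 1 by field_simp; ring,
      Real.rpow_add hx0, Real.rpow_one]
  have hkey : a * x + b < (x : ℝ) ^ κ * x := by
    have : (a + |b| + 1) * x ≤ (x : ℝ) ^ κ * x := mul_le_mul_of_nonneg_right (by simpa using hx) hx0.le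
    have hb : b ≤ |b| * x := by
      calc b ≤ |b| := le_abs_self b
        _ = |b| * 1 := (mul_one _).symm
        _ ≤ |b| * x := mul_le_mul_of_nonneg_left hx1' (abs_nonneg b)
    nlinarith
  calc a * x + b < (x : ℝ) ^ κ * x := hkey
    _ = ((x : ℝ) ^ (1 / U)) ^ (⌊U⌋₊ + 1) := hxpow.symm
    _ ≤ _ := hzpow

/-! ### The error budget -/

/-- `C X^{1−s} ≤ δ · X/(log X)^{B'}` eventually, for `0 < s`, `C ≥ 0`, `δ > 0`. [folklore] -/
theorem eventually_term_le {s : ℝ} (hs : 0 < s) (B' : ℝ) {C δ : ℝ} (hC : 0 ≤ C) (hδ : 0 < δ) :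
    ∀ᶠ X : ℝ in atTop, C * X ^ (1 - s) ≤ δ * (X / Real.log X ^ B') := by
  have h := (tendsto_log_pow_div_rpow hs B').eventually
    (eventually_le_nhds (show 0 < δ / (C + 1) by positivity))
  filter_upwards [h, eventually_gt_atTop (1 : ℝ)] with X hX hX1
  have hX0 : 0 < X := by linarith
  have hL : 0 < Real.log X := Real.log_pos hX1
  have hLB : 0 < Real.log X ^ B' := Real.rpow_pos_of_pos hL _
  have hXs : 0 < X ^ s := Real.rpow_pos_of_pos hX0 _
  have hX1s : 0 ≤ X ^ (1 - s) := Real.rpow_nonneg hX0.le _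
  have h1 : C * (Real.log X ^ B' / X ^ s) ≤ δ := by
    calc C * (Real.log X ^ B' / X ^ s) ≤ C * (δ / (C + 1)) := mul_le_mul_of_nonneg_left hX hC
      _ = δ * (C / (C + 1)) := by ring
      _ ≤ δ * 1 := mul_le_mul_of_nonneg_left ((div_le_one (by positivity)).mpr (by linarith)) hδ.le
      _ = δ := mul_one δ
  have e : X ^ (1 - s) * X ^ s = X := by
    rw [← Real.rpow_add hX0]; norm_num
  -- multiply `h1` by `X^{1-s} X^s / log^{B'} X`
  have key : C * X ^ (1 - s) * Real.log X ^ B' ≤ δ * X := by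
    have := mul_le_mul_of_nonneg_right h1 (mul_nonneg hX1s hXs.le)
    calc C * X ^ (1 - s) * Real.log X ^ B' = C * (Real.log X ^ B' / X ^ s) * (X ^ (1 - s) * X ^ s) := by
          field_simp
      _ ≤ δ * (X ^ (1 - s) * X ^ s) := this
      _ = δ * X := by rw [e]
  rw [mul_div_assoc', le_div_iff₀ hLB]
  exact key

/-- **Relating the crux's quantities to `X = a x + b`** (`a ≥ 1`, `U ≥ 1`): eventually in `x`,
`X ≥ 1`, `x ≤ 2X`, `z = ⌈x^{1/U}⌉₊ ≤ 4 X^{1/U}`, `2x/z ≤ 4 X^{1−1/U}`, `√X = X^{1/2}`. [folklore] -/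
theorem eventually_threshold_vs_linear {a b : ℝ} (ha : 1 ≤ a) {U : ℝ} (hU : 1 ≤ U) :
    ∀ᶠ x : ℕ in atTop, 1 ≤ a * x + b ∧ (x : ℝ) ≤ 2 * (a * x + b) ∧
      (⌈(x : ℝ) ^ (1 / U)⌉₊ : ℝ) ≤ 4 * (a * x + b) ^ (1 / U) ∧
      2 * (x : ℝ) / (⌈(x : ℝ) ^ (1 / U)⌉₊ : ℝ) ≤ 4 * (a * x + b) ^ (1 - 1 / U) := by
  have hU0 : 0 < U := by linarith
  have h1U : 0 ≤ 1 / U := by positivity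
  have h1U' : 1 / U ≤ 1 := by rw [div_le_one hU0]; exact hU
  filter_upwards [eventually_ge_atTop (max 1 (Nat.ceil (|b|) * 2 + 2))] with x hx
  have hx1 : 1 ≤ x := (le_max_left _ _).trans hx
  have hx1' : (1 : ℝ) ≤ x := by exact_mod_cast hx1
  have hx0 : (0 : ℝ) < x := by linarith
  have hxb : 2 * |b| + 2 ≤ (x : ℝ) := by
    have h := (le_max_right _ _).trans hx
    have : ((Nat.ceil (|b|) * 2 + 2 : ℕ) : ℝ) ≤ x := by exact_mod_cast h
    push_cast at this
    linarith [Nat.le_ceil (|b|)]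
  set X : ℝ := a * x + b with hX
  have hXx : (x : ℝ) - |b| ≤ X := by
    rw [hX]; nlinarith [neg_abs_le b, abs_nonneg b]
  have hX1 : 1 ≤ X := by linarith [abs_nonneg b]
  have hX0 : 0 < X := by linarith
  have hx2X : (x : ℝ) ≤ 2 * X := by linarith [abs_nonneg b]
  obtain ⟨hz1, hz2, hz3⟩ := threshold_bounds hx1 hU0
  have hxU : (x : ℝ) ^ (1 / U) ≤ 2 * X ^ (1 / U) := by
    calc (x : ℝ) ^ (1 / U) ≤ (2 * X) ^ (1 / U) := Real.rpow_le_rpow hx0.le hx2X h1U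
      _ = (2 : ℝ) ^ (1 / U) * X ^ (1 / U) := Real.mul_rpow (by norm_num) hX0.le
      _ ≤ 2 * X ^ (1 / U) := by
          apply mul_le_mul_of_nonneg_right _ (by positivity)
          calc (2 : ℝ) ^ (1 / U) ≤ (2 : ℝ) ^ (1 : ℝ) := Real.rpow_le_rpow_of_exponent_le one_le_two h1U'
            _ = 2 := Real.rpow_one 2
  refine ⟨hX1, hx2X, by linarith, ?_⟩
  -- `2x/z ≤ 2x/x^{1/U} = 2 x^{1−1/U} ≤ 2 (2X)^{1−1/U} ≤ 4 X^{1−1/U}`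
  have hz0 : (0 : ℝ) < ⌈(x : ℝ) ^ (1 / U)⌉₊ := by exact_mod_cast hz3
  have hxpow : (x : ℝ) / (x : ℝ) ^ (1 / U) = (x : ℝ) ^ (1 - 1 / U) := by
    rw [Real.rpow_sub hx0, Real.rpow_one]
  have h1 : 2 * (x : ℝ) / (⌈(x : ℝ) ^ (1 / U)⌉₊ : ℝ) ≤ 2 * (x : ℝ) ^ (1 - 1 / U) := by
    rw [mul_div_assoc, ← hxpow]
    exact mul_le_mul_of_nonneg_left (div_le_div_of_nonneg_left hx0.le (Real.rpow_pos_of_pos hx0 _) hz1)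
      (by norm_num)
  have h2 : (x : ℝ) ^ (1 - 1 / U) ≤ 2 * X ^ (1 - 1 / U) := by
    have h01 : 0 ≤ 1 - 1 / U := by linarith
    calc (x : ℝ) ^ (1 - 1 / U) ≤ (2 * X) ^ (1 - 1 / U) := Real.rpow_le_rpow hx0.le hx2X h01
      _ = (2 : ℝ) ^ (1 - 1 / U) * X ^ (1 - 1 / U) := Real.mul_rpow (by norm_num) hX0.le
      _ ≤ 2 * X ^ (1 - 1 / U) := by
          apply mul_le_mul_of_nonneg_right _ (by positivity)
          calc (2 : ℝ) ^ (1 - 1 / U) ≤ (2 : ℝ) ^ (1 : ℝ) :=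
                Real.rpow_le_rpow_of_exponent_le one_le_two (by linarith)
            _ = 2 := Real.rpow_one 2
  linarith

/-- **The error budget is eventually small**: for `a ≥ 1`, `U > 1`, `C₁, C₂ ≥ 0`, `δ > 0`, any `B'`:
eventually in `x`, with `X = a x + b` and `z = ⌈x^{1/U}⌉₊`,
`C₁ z + C₂ + 2x/z + √X + 1 ≤ δ · X/(log X)^{B'}`. [folklore] -/
theorem eventually_errors_le {a b : ℝ} (ha : 1 ≤ a) {U : ℝ} (hU : 1 < U) (B' : ℝ) {C₁ C₂ δ : ℝ}
    (hC₁ : 0 ≤ C₁) (hC₂ : 0 ≤ C₂) (hδ : 0 < δ) :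
    ∀ᶠ x : ℕ in atTop, C₁ * (⌈(x : ℝ) ^ (1 / U)⌉₊ : ℝ) + C₂ + 2 * (x : ℝ) / (⌈(x : ℝ) ^ (1 / U)⌉₊ : ℝ) +
      Real.sqrt (a * x + b) + 1 ≤ δ * ((a * x + b) / Real.log (a * x + b) ^ B') := by
  have ha0 : 0 < a := by linarith
  have hU0 : 0 < U := by linarith
  have hs1 : 0 < 1 - 1 / U := by
    rw [sub_pos, div_lt_one hU0]; exact hU
  have hs2 : 0 < 1 / U := by positivity
  have hδ4 : 0 < δ / 4 := by positivity
  have hlin := tendsto_linear_atTop ha0 b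
  -- the four terms, pulled back along `X = a x + b`
  have t1 := hlin.eventually (eventually_term_le hs1 B' (C := 4 * C₁) (by positivity) hδ4)
  have t2 := hlin.eventually (eventually_term_le hs2 B' (C := 4) (by norm_num) hδ4)
  have t3 := hlin.eventually (eventually_term_le (s := 1 / 2) (by norm_num) B' (C := 1) zero_le_one hδ4)
  have t4 := hlin.eventually (eventually_term_le (s := 1) one_pos B' (C := C₂ + 1) (by positivity) hδ4)
  filter_upwards [t1, t2, t3, t4, eventually_threshold_vs_linear ha hU.le] with x h1 h2 h3 h4 hx
  obtain ⟨hX1, -, hz, hxz⟩ := hx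
  set X : ℝ := a * x + b with hX
  have hX0 : 0 < X := by linarith
  -- rewrite the exponents
  have e1 : X ^ (1 - (1 - 1 / U)) = X ^ (1 / U) := by congr 1; ring
  have e3 : X ^ (1 - (1 / 2 : ℝ)) = Real.sqrt X := by
    rw [Real.sqrt_eq_rpow]; congr 1; norm_num
  have e4 : X ^ (1 - (1 : ℝ)) = 1 := by rw [sub_self, Real.rpow_zero]
  rw [e1] at h1
  rw [e3] at h3
  rw [e4, mul_one] at h4
  have hz' : C₁ * (⌈(x : ℝ) ^ (1 / U)⌉₊ : ℝ) ≤ 4 * C₁ * X ^ (1 / U) := by nlinarith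
  linarith

end PrimeBackground

/-- **Sub-goal (error budget of the prime-background step)**, registered on crux stmt-Parity-15629 as
`stub_primeBackgroundErrorBudget`, verbatim: with `X = a x + b` (`a ≥ 1`), `z = ⌈x^{1/U}⌉₊` (`U > 1`),
the boundary terms `C₁ z + C₂ + 2x/z + √X + 1` are eventually `≤ δ·X/(log X)^{B'}`
(`PrimeBackground.eventually_errors_le`). [folklore] -/
theorem stub_primeBackgroundErrorBudget :
    ∀ (a b : ℝ), 1 ≤ a → ∀ (U : ℝ), 1 < U → ∀ (B' C₁ C₂ δ : ℝ), 0 ≤ C₁ → 0 ≤ C₂ → 0 < δ → ∀ᶠ x : ℕ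
    in Filter.atTop, C₁ * (⌈(x : ℝ) ^ (1 / U)⌉₊ : ℝ) + C₂ + 2 * (x : ℝ) / (⌈(x : ℝ) ^ (1 / U)⌉₊ : ℝ)
    + Real.sqrt (a * x + b) + 1 ≤ δ * ((a * x + b) / Real.log (a * x + b) ^ B') :=
  fun _ _ ha _ hU B' _ _ _ hC₁ hC₂ hδ => PrimeBackground.eventually_errors_le ha hU B' hC₁ hC₂ hδ

end Summit.Parity.BatemanHorn.Cruxes.OddSectorShareLinear.Birth

end
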